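import Summits.AtomisticToContinuum.HydrodynamicLimit.Theorems.CollisionIsometryCLTAdaptedWeightCLTBHEntropyBudgetDerivInt

/-!
# Entropy budget (stub `stub_entropyBudget`, line `block-h-dissipation-closure`, crux `AdaptedWeightCLT`,
stmt-AtomisticToContinuum-14868; `--supports`) — helper 10: the mass-weighted cell entropy `S_N` along a
free flight (differentiation under the torus integral) and the size of the transport rate

* `r ↦ S_N(freeFlight r w) = ∫ₓ (N+1)⁻¹ cW · H(f̂)` is differentiable at `0` with derivative
  `∫ₓ (N+1)⁻¹ D_x dx` (helper 8 for every `x`, locally uniformly in `r` by the shift lemma; the dominator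
  over the torus is the constant `(N+1)⁻¹ (N+1) L V R`; measurability of `x ↦ D_x` by the difference-quotient
  limit of measurable functions) — hence differentiable everywhere (shift lemma);
* THE TRANSPORT RATE IS `O((N+1)^γ)`: `|∫ₓ (N+1)⁻¹ D_x| ≤ L V R · ((N+1)^{-γ})³ |B₁| ` because `D_x` vanishes off
  the `(N+1)^{-γ}`-balls about the particles (`|D_x| ≤ B₁ R`, `B₁ ≤ L V #{i : cw_i(x) ≠ 0}`), and
  `L ((N+1)^{-γ})³ = C (N+1)^{γ}` for an admissible kernel (`L = C (N+1)^{4γ}`).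
-/

namespace Summit.AtomisticToContinuum.HydrodynamicLimit.Theorems.BlockHDissipation

open scoped BigOperators Topology Classical MeasureTheory ENNReal InnerProductSpace
open Filter Set MeasureTheory
open Literature.Analysis.FluidPDE
open Literature.Analysis.FunctionSpaces (Torus.IsSmooth)
open Summit.AtomisticToContinuum.HydrodynamicLimit.Theorems.ContactSourceDuhamel (T3 V3 Cfg Vel Flow Flows)
open Summit.AtomisticToContinuum.HydrodynamicLimit.Theorems.ContactSourceDuhamel.TimeLocal
open Literature.MathematicalPhysics.KineticTheory (localMaxwellian_pos localMaxwellian_nonneg continuous_localMaxwellian)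

noncomputable section

namespace EntropyBudget

variable {N : ℕ} {ψ : ℕ → T3 → ℝ} {h δ : ℝ} (w : Cfg N) (x : T3)


/-! ## Measurability of a derivative in a parameter, by difference quotients -/

/-- If `x ↦ F(s, x)` is a.e.-strongly measurable for every `s` and `s ↦ F(s, x)` has derivative `F'(x)` at `0`
for every `x`, then `F'` is a.e.-strongly measurable (pointwise limit of difference quotients). -/
theorem aestronglyMeasurable_of_hasDerivAt {F : ℝ → T3 → ℝ} {F' : T3 → ℝ}
    (hmeas : ∀ s, AEStronglyMeasurable (F s) (volume : Measure T3)) (hd : ∀ x, HasDerivAt (F · x) (F' x) 0) :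
    AEStronglyMeasurable F' (volume : Measure T3) := by
  refine aestronglyMeasurable_of_tendsto_ae atTop
    (f := fun (n : ℕ) x => (1 / ((n : ℝ) + 1))⁻¹ * (F (1 / ((n : ℝ) + 1)) x - F 0 x))
    (fun n => (((hmeas _).sub (hmeas 0)).const_mul _)) (ae_of_all _ fun x => ?_)
  have h1 := (hd x).tendsto_slope_zero
  have h2 : Tendsto (fun n : ℕ => 1 / ((n : ℝ) + 1)) atTop (𝓝[≠] 0) := by
    refine tendsto_nhdsWithin_iff.2 ⟨tendsto_one_div_add_atTop_nhds_zero_nat, Eventually.of_forall fun n => ?_⟩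
    exact one_div_ne_zero (by positivity)
  have := h1.comp h2
  simpa [Function.comp_def, zero_add] using this

/-! ## `S_N` along a free flight -/

/-- **`S_N` IS DIFFERENTIABLE ALONG A FREE FLIGHT**, with derivative `∫ₓ (N+1)⁻¹ D_x dx` at `r = 0`
(differentiation under the torus integral; `R` is any velocity-uniform size of `D_x` in units of `B₁`). -/
theorem hasDerivAt_entS (hψs : Torus.IsSmooth (ψ N)) (hψ : ∀ y, 0 ≤ ψ N y) (hψc : Continuous (ψ N)) {A L V : ℝ}
    (hA : ∀ y, ψ N y ≤ A) (hL : ∀ y, ‖Literature.Analysis.FunctionSpaces.Torus.gradient (ψ N) y‖ ≤ L)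
    (hV : ∀ i, ‖(w i).2‖ ≤ V) (hh : 0 < h) (hδ : 0 < δ) (hδ1 : δ ≤ 1) {R : ℝ} (hR0 : 0 ≤ R)
    (hR : ∀ w' : Cfg N, (∀ i, (w' i).2 = (w i).2) → ∀ x, |((∑ i, Literature.Analysis.FunctionSpaces.Torus.fderiv (ψ N) ((w' i).1 - x) (w' i).2) *
        cellEnt N ψ h δ w' x + ∫ v, (1 + Real.log (cellLaw N ψ h δ w' x v)) * ((1 - δ) *
        (-(∑ i, Literature.Analysis.FunctionSpaces.Torus.fderiv (ψ N) ((w' i).1 - x) (w' i).2) * kde N ψ h w' x (v) +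
        ∑ i, Literature.Analysis.FunctionSpaces.Torus.fderiv (ψ N) ((w' i).1 - x) (w' i).2 * gauss h (w' i).2 (v)) + δ *
        (localMaxwellian 1 (cT N ψ w' x + h ^ 2) (cU N ψ w' x) (v) * ((-(∑ i, Literature.Analysis.FunctionSpaces.Torus.fderiv (ψ N) ((w' i).1 -
        x) (w' i).2) * cT N ψ w' x + ∑ i, Literature.Analysis.FunctionSpaces.Torus.fderiv (ψ N) ((w' i).1 - x) (w' i).2 * (‖(w' i).2 -
        cU N ψ w' x‖ ^ 2 / 3)) * (‖(v) - cU N ψ w' x‖ ^ 2 / (2 * (cT N ψ w' x + h ^ 2) ^ 2) - 3 / (2 * (cT N ψ w' x + h ^ 2))) + inner ℝ ((v) -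
        cU N ψ w' x) (-(∑ i, Literature.Analysis.FunctionSpaces.Torus.fderiv (ψ N) ((w' i).1 - x) (w' i).2) • cU N ψ w' x +
        ∑ i, Literature.Analysis.FunctionSpaces.Torus.fderiv (ψ N) ((w' i).1 - x) (w' i).2 • (w' i).2) / (cT N ψ w' x + h ^ 2)))))| ≤
        (∑ i, |Literature.Analysis.FunctionSpaces.Torus.fderiv (ψ N) ((w' i).1 - x) (w' i).2|) * R) :
    HasDerivAt (fun s => entS N ψ h δ (freeFlight (Torus.geometry (Fin 3)) s w)) (∫ x, ((N + 1 : ℕ) : ℝ)⁻¹ *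
        ((∑ i, Literature.Analysis.FunctionSpaces.Torus.fderiv (ψ N) ((w i).1 - x) (w i).2) * cellEnt N ψ h δ w x + ∫ v, (1 +
        Real.log (cellLaw N ψ h δ w x v)) * ((1 - δ) * (-(∑ i, Literature.Analysis.FunctionSpaces.Torus.fderiv (ψ N) ((w i).1 - x) (w i).2) *
        kde N ψ h w x (v) + ∑ i, Literature.Analysis.FunctionSpaces.Torus.fderiv (ψ N) ((w i).1 - x) (w i).2 * gauss h (w i).2 (v)) + δ *
        (localMaxwellian 1 (cT N ψ w x + h ^ 2) (cU N ψ w x) (v) * ((-(∑ i, Literature.Analysis.FunctionSpaces.Torus.fderiv (ψ N) ((w i).1 -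
        x) (w i).2) * cT N ψ w x + ∑ i, Literature.Analysis.FunctionSpaces.Torus.fderiv (ψ N) ((w i).1 - x) (w i).2 * (‖(w i).2 -
        cU N ψ w x‖ ^ 2 / 3)) * (‖(v) - cU N ψ w x‖ ^ 2 / (2 * (cT N ψ w x + h ^ 2) ^ 2) - 3 / (2 * (cT N ψ w x + h ^ 2))) + inner ℝ ((v) -
        cU N ψ w x) (-(∑ i, Literature.Analysis.FunctionSpaces.Torus.fderiv (ψ N) ((w i).1 - x) (w i).2) • cU N ψ w x +
        ∑ i, Literature.Analysis.FunctionSpaces.Torus.fderiv (ψ N) ((w i).1 - x) (w i).2 • (w i).2) / (cT N ψ w x + h ^ 2)))))) 0 := by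
  have hN : (0 : ℝ) < ((N + 1 : ℕ) : ℝ) := by positivity
  have hV0 := V_nonneg w hV
  have hL0 := L_nonneg hL
  have hA0 : 0 ≤ A := (hψ 0).trans (hA 0)
  -- the derivative at every `x`, everywhere in `s`
  have hdiff : ∀ (x : T3) (s : ℝ), HasDerivAt (fun s => ((N + 1 : ℕ) : ℝ)⁻¹ * (cW N ψ (freeFlight (Torus.geometry (Fin 3)) s w) x *
      cellEnt N ψ h δ (freeFlight (Torus.geometry (Fin 3)) s w) x))
      (((N + 1 : ℕ) : ℝ)⁻¹ * ((∑ i, Literature.Analysis.FunctionSpaces.Torus.fderiv (ψ N) (((freeFlight (Torus.geometry (Fin 3)) s w) i).1 -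
          x) ((freeFlight (Torus.geometry (Fin 3)) s w) i).2) * cellEnt N ψ h δ (freeFlight (Torus.geometry (Fin 3)) s w) x + ∫ v, (1 +
          Real.log (cellLaw N ψ h δ (freeFlight (Torus.geometry (Fin 3)) s w) x v)) * ((1 - δ) *
          (-(∑ i, Literature.Analysis.FunctionSpaces.Torus.fderiv (ψ N) (((freeFlight (Torus.geometry (Fin 3)) s w) i).1 -
          x) ((freeFlight (Torus.geometry (Fin 3)) s w) i).2) * kde N ψ h (freeFlight (Torus.geometry (Fin 3)) s w) x (v) +
          ∑ i, Literature.Analysis.FunctionSpaces.Torus.fderiv (ψ N) (((freeFlight (Torus.geometry (Fin 3)) s w) i).1 -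
          x) ((freeFlight (Torus.geometry (Fin 3)) s w) i).2 * gauss h ((freeFlight (Torus.geometry (Fin 3)) s w) i).2 (v)) + δ *
          (localMaxwellian 1 (cT N ψ (freeFlight (Torus.geometry (Fin 3)) s w) x + h ^ 2) (cU N ψ (freeFlight (Torus.geometry (Fin 3)) s w) x) (v) *
          ((-(∑ i, Literature.Analysis.FunctionSpaces.Torus.fderiv (ψ N) (((freeFlight (Torus.geometry (Fin 3)) s w) i).1 -
          x) ((freeFlight (Torus.geometry (Fin 3)) s w) i).2) * cT N ψ (freeFlight (Torus.geometry (Fin 3)) s w) x +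
          ∑ i, Literature.Analysis.FunctionSpaces.Torus.fderiv (ψ N) (((freeFlight (Torus.geometry (Fin 3)) s w) i).1 -
          x) ((freeFlight (Torus.geometry (Fin 3)) s w) i).2 * (‖((freeFlight (Torus.geometry (Fin 3)) s w) i).2 -
          cU N ψ (freeFlight (Torus.geometry (Fin 3)) s w) x‖ ^ 2 / 3)) * (‖(v) - cU N ψ (freeFlight (Torus.geometry (Fin 3)) s w) x‖ ^ 2 / (2 *
          (cT N ψ (freeFlight (Torus.geometry (Fin 3)) s w) x + h ^ 2) ^ 2) - 3 / (2 * (cT N ψ (freeFlight (Torus.geometry (Fin 3)) s w) x +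
          h ^ 2))) + inner ℝ ((v) -
          cU N ψ (freeFlight (Torus.geometry (Fin 3)) s w) x) (-(∑ i, Literature.Analysis.FunctionSpaces.Torus.fderiv (ψ N) (((freeFlight (Torus.geometry (Fin 3)) s w) i).1 -
          x) ((freeFlight (Torus.geometry (Fin 3)) s w) i).2) • cU N ψ (freeFlight (Torus.geometry (Fin 3)) s w) x +
          ∑ i, Literature.Analysis.FunctionSpaces.Torus.fderiv (ψ N) (((freeFlight (Torus.geometry (Fin 3)) s w) i).1 -
          x) ((freeFlight (Torus.geometry (Fin 3)) s w) i).2 • ((freeFlight (Torus.geometry (Fin 3)) s w) i).2) / (cT N ψ (freeFlight (Torus.geometry (Fin 3)) s w) x +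
          h ^ 2)))))) s := by
    intro x s
    have h1 := hasDerivAt_cW_mul_cellEnt (δ := δ) (freeFlight (Torus.geometry (Fin 3)) s w) x hψs hψ hA hL (fun i => hV i) hh hδ hδ1
    have h2 := hasDerivAt_shift w (fun w' => cW N ψ w' x * cellEnt N ψ h δ w' x) h1
    exact h2.const_mul (((N + 1 : ℕ) : ℝ)⁻¹)
  have hmeas : ∀ s, AEStronglyMeasurable (fun x => ((N + 1 : ℕ) : ℝ)⁻¹ * (cW N ψ (freeFlight (Torus.geometry (Fin 3)) s w) x *
      cellEnt N ψ h δ (freeFlight (Torus.geometry (Fin 3)) s w) x))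
      (volume : Measure T3) := fun s =>
    (((continuous_cW (freeFlight (Torus.geometry (Fin 3)) s w) hψc).measurable.mul (measurable_cellEnt (freeFlight (Torus.geometry (Fin 3)) s w) hψc)).const_mul _).aestronglyMeasurable
  have key := hasDerivAt_integral_of_dominated_loc_of_deriv_le (μ := (volume : Measure T3)) (x₀ := (0 : ℝ))
    (F := fun s x => ((N + 1 : ℕ) : ℝ)⁻¹ * (cW N ψ (freeFlight (Torus.geometry (Fin 3)) s w) x *
        cellEnt N ψ h δ (freeFlight (Torus.geometry (Fin 3)) s w) x))
    (F' := fun s x => ((N + 1 : ℕ) : ℝ)⁻¹ *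
        ((∑ i, Literature.Analysis.FunctionSpaces.Torus.fderiv (ψ N) (((freeFlight (Torus.geometry (Fin 3)) s w) i).1 -
        x) ((freeFlight (Torus.geometry (Fin 3)) s w) i).2) * cellEnt N ψ h δ (freeFlight (Torus.geometry (Fin 3)) s w) x + ∫ v, (1 +
        Real.log (cellLaw N ψ h δ (freeFlight (Torus.geometry (Fin 3)) s w) x v)) * ((1 - δ) *
        (-(∑ i, Literature.Analysis.FunctionSpaces.Torus.fderiv (ψ N) (((freeFlight (Torus.geometry (Fin 3)) s w) i).1 -
        x) ((freeFlight (Torus.geometry (Fin 3)) s w) i).2) * kde N ψ h (freeFlight (Torus.geometry (Fin 3)) s w) x (v) +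
        ∑ i, Literature.Analysis.FunctionSpaces.Torus.fderiv (ψ N) (((freeFlight (Torus.geometry (Fin 3)) s w) i).1 -
        x) ((freeFlight (Torus.geometry (Fin 3)) s w) i).2 * gauss h ((freeFlight (Torus.geometry (Fin 3)) s w) i).2 (v)) + δ *
        (localMaxwellian 1 (cT N ψ (freeFlight (Torus.geometry (Fin 3)) s w) x + h ^ 2) (cU N ψ (freeFlight (Torus.geometry (Fin 3)) s w) x) (v) *
        ((-(∑ i, Literature.Analysis.FunctionSpaces.Torus.fderiv (ψ N) (((freeFlight (Torus.geometry (Fin 3)) s w) i).1 -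
        x) ((freeFlight (Torus.geometry (Fin 3)) s w) i).2) * cT N ψ (freeFlight (Torus.geometry (Fin 3)) s w) x +
        ∑ i, Literature.Analysis.FunctionSpaces.Torus.fderiv (ψ N) (((freeFlight (Torus.geometry (Fin 3)) s w) i).1 -
        x) ((freeFlight (Torus.geometry (Fin 3)) s w) i).2 * (‖((freeFlight (Torus.geometry (Fin 3)) s w) i).2 -
        cU N ψ (freeFlight (Torus.geometry (Fin 3)) s w) x‖ ^ 2 / 3)) * (‖(v) - cU N ψ (freeFlight (Torus.geometry (Fin 3)) s w) x‖ ^ 2 / (2 *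
        (cT N ψ (freeFlight (Torus.geometry (Fin 3)) s w) x + h ^ 2) ^ 2) - 3 / (2 * (cT N ψ (freeFlight (Torus.geometry (Fin 3)) s w) x + h ^ 2))) +
        inner ℝ ((v) -
        cU N ψ (freeFlight (Torus.geometry (Fin 3)) s w) x) (-(∑ i, Literature.Analysis.FunctionSpaces.Torus.fderiv (ψ N) (((freeFlight (Torus.geometry (Fin 3)) s w) i).1 -
        x) ((freeFlight (Torus.geometry (Fin 3)) s w) i).2) • cU N ψ (freeFlight (Torus.geometry (Fin 3)) s w) x +
        ∑ i, Literature.Analysis.FunctionSpaces.Torus.fderiv (ψ N) (((freeFlight (Torus.geometry (Fin 3)) s w) i).1 -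
        x) ((freeFlight (Torus.geometry (Fin 3)) s w) i).2 • ((freeFlight (Torus.geometry (Fin 3)) s w) i).2) / (cT N ψ (freeFlight (Torus.geometry (Fin 3)) s w) x +
        h ^ 2))))))
    (bound := fun _ => L * V * R) (Metric.ball_mem_nhds (0 : ℝ) one_pos) (Eventually.of_forall hmeas) ?_ ?_ ?_
    (integrable_const _) (ae_of_all _ fun x s _ => hdiff x s)
  · have e1 : (fun s => entS N ψ h δ (freeFlight (Torus.geometry (Fin 3)) s w)) =
        fun s => ∫ x, ((N + 1 : ℕ) : ℝ)⁻¹ * (cW N ψ (freeFlight (Torus.geometry (Fin 3)) s w) x *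
            cellEnt N ψ h δ (freeFlight (Torus.geometry (Fin 3)) s w) x) := by
      funext s
      unfold entS
      exact integral_congr_ae (ae_of_all _ fun x => by ring)
    rw [e1]
    have k2 := key.2
    simp only [freeFlight_zero] at k2
    exact k2
  · -- integrability at `s = 0`: a bounded measurable function on a probability space
    refine Integrable.mono' (integrable_const (((N + 1 : ℕ) : ℝ)⁻¹ *
      ((|Real.log ((2 * Real.pi * h ^ 2) ^ (-(3 : ℝ) / 2))| + |Real.log δ| + 3 * Real.pi * h ^ 2) * (((N + 1 : ℕ) : ℝ) * A) +
        Real.pi * (((N + 1 : ℕ) : ℝ) * (A * V ^ 2))))) (hmeas 0) (ae_of_all _ fun x => ?_)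
    simp only [freeFlight_zero]
    rw [Real.norm_eq_abs, abs_mul, abs_of_pos (inv_pos.2 hN)]
    refine mul_le_mul_of_nonneg_left ((abs_cW_mul_cellEnt_le w x hψ hh hδ hδ1).trans (add_le_add ?_ ?_)) (inv_pos.2 hN).le
    · refine mul_le_mul_of_nonneg_left ?_ (by positivity)
      calc cW N ψ w x = ∑ i, cw N ψ w x i := rfl
        _ ≤ ∑ _i : Fin (N + 1), A := Finset.sum_le_sum fun i _ => hA _
        _ = ((N + 1 : ℕ) : ℝ) * A := by rw [Finset.sum_const, Finset.card_univ, Fintype.card_fin, nsmul_eq_mul]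
    · refine mul_le_mul_of_nonneg_left ?_ Real.pi_pos.le
      calc ∑ i, cw N ψ w x i * ‖(w i).2‖ ^ 2 ≤ ∑ _i : Fin (N + 1), A * V ^ 2 := Finset.sum_le_sum fun i _ =>
            mul_le_mul (hA _) (pow_le_pow_left₀ (norm_nonneg _) (hV i) 2) (sq_nonneg _) hA0
        _ = ((N + 1 : ℕ) : ℝ) * (A * V ^ 2) := by rw [Finset.sum_const, Finset.card_univ, Fintype.card_fin, nsmul_eq_mul]
  · -- measurability of `x ↦ (N+1)⁻¹ D_x`: limit of difference quotients
    have := aestronglyMeasurable_of_hasDerivAt hmeas fun x => hdiff x 0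
    simpa only [freeFlight_zero] using this
  · -- the uniform bound `(N+1)⁻¹ |D_x| ≤ L V R`
    refine ae_of_all _ fun x s _ => ?_
    rw [Real.norm_eq_abs, abs_mul, abs_of_pos (inv_pos.2 hN)]
    have h1 := hR (freeFlight (Torus.geometry (Fin 3)) s w) (fun i => rfl) x
    have h2 := B1_le (freeFlight (Torus.geometry (Fin 3)) s w) x hL (fun i => hV i)
    calc ((N + 1 : ℕ) : ℝ)⁻¹ * |((∑ i, Literature.Analysis.FunctionSpaces.Torus.fderiv (ψ N) (((freeFlight (Torus.geometry (Fin 3)) s w) i).1 -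
        x) ((freeFlight (Torus.geometry (Fin 3)) s w) i).2) * cellEnt N ψ h δ (freeFlight (Torus.geometry (Fin 3)) s w) x + ∫ v, (1 +
        Real.log (cellLaw N ψ h δ (freeFlight (Torus.geometry (Fin 3)) s w) x v)) * ((1 - δ) *
        (-(∑ i, Literature.Analysis.FunctionSpaces.Torus.fderiv (ψ N) (((freeFlight (Torus.geometry (Fin 3)) s w) i).1 -
        x) ((freeFlight (Torus.geometry (Fin 3)) s w) i).2) * kde N ψ h (freeFlight (Torus.geometry (Fin 3)) s w) x (v) +
        ∑ i, Literature.Analysis.FunctionSpaces.Torus.fderiv (ψ N) (((freeFlight (Torus.geometry (Fin 3)) s w) i).1 -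
        x) ((freeFlight (Torus.geometry (Fin 3)) s w) i).2 * gauss h ((freeFlight (Torus.geometry (Fin 3)) s w) i).2 (v)) + δ *
        (localMaxwellian 1 (cT N ψ (freeFlight (Torus.geometry (Fin 3)) s w) x + h ^ 2) (cU N ψ (freeFlight (Torus.geometry (Fin 3)) s w) x) (v) *
        ((-(∑ i, Literature.Analysis.FunctionSpaces.Torus.fderiv (ψ N) (((freeFlight (Torus.geometry (Fin 3)) s w) i).1 -
        x) ((freeFlight (Torus.geometry (Fin 3)) s w) i).2) * cT N ψ (freeFlight (Torus.geometry (Fin 3)) s w) x +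
        ∑ i, Literature.Analysis.FunctionSpaces.Torus.fderiv (ψ N) (((freeFlight (Torus.geometry (Fin 3)) s w) i).1 -
        x) ((freeFlight (Torus.geometry (Fin 3)) s w) i).2 * (‖((freeFlight (Torus.geometry (Fin 3)) s w) i).2 -
        cU N ψ (freeFlight (Torus.geometry (Fin 3)) s w) x‖ ^ 2 / 3)) * (‖(v) - cU N ψ (freeFlight (Torus.geometry (Fin 3)) s w) x‖ ^ 2 / (2 *
        (cT N ψ (freeFlight (Torus.geometry (Fin 3)) s w) x + h ^ 2) ^ 2) - 3 / (2 * (cT N ψ (freeFlight (Torus.geometry (Fin 3)) s w) x + h ^ 2))) +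
        inner ℝ ((v) -
        cU N ψ (freeFlight (Torus.geometry (Fin 3)) s w) x) (-(∑ i, Literature.Analysis.FunctionSpaces.Torus.fderiv (ψ N) (((freeFlight (Torus.geometry (Fin 3)) s w) i).1 -
        x) ((freeFlight (Torus.geometry (Fin 3)) s w) i).2) • cU N ψ (freeFlight (Torus.geometry (Fin 3)) s w) x +
        ∑ i, Literature.Analysis.FunctionSpaces.Torus.fderiv (ψ N) (((freeFlight (Torus.geometry (Fin 3)) s w) i).1 -
        x) ((freeFlight (Torus.geometry (Fin 3)) s w) i).2 • ((freeFlight (Torus.geometry (Fin 3)) s w) i).2) / (cT N ψ (freeFlight (Torus.geometry (Fin 3)) s w) x +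
        h ^ 2)))))| ≤ ((N + 1 : ℕ) : ℝ)⁻¹ * (((N + 1 : ℕ) : ℝ) * L * V * R) :=
          mul_le_mul_of_nonneg_left (h1.trans (mul_le_mul_of_nonneg_right h2 hR0)) (inv_pos.2 hN).le
      _ = L * V * R := by field_simp

/-- Hence `r ↦ S_N(freeFlight r w)` is differentiable EVERYWHERE. -/
theorem differentiableAt_entS (hψs : Torus.IsSmooth (ψ N)) (hψ : ∀ y, 0 ≤ ψ N y) (hψc : Continuous (ψ N)) {A L V : ℝ}
    (hA : ∀ y, ψ N y ≤ A) (hL : ∀ y, ‖Literature.Analysis.FunctionSpaces.Torus.gradient (ψ N) y‖ ≤ L)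
    (hV : ∀ i, ‖(w i).2‖ ≤ V) (hh : 0 < h) (hδ : 0 < δ) (hδ1 : δ ≤ 1) {R : ℝ} (hR0 : 0 ≤ R)
    (hR : ∀ w' : Cfg N, (∀ i, (w' i).2 = (w i).2) → ∀ x, |((∑ i, Literature.Analysis.FunctionSpaces.Torus.fderiv (ψ N) ((w' i).1 - x) (w' i).2) *
        cellEnt N ψ h δ w' x + ∫ v, (1 + Real.log (cellLaw N ψ h δ w' x v)) * ((1 - δ) *
        (-(∑ i, Literature.Analysis.FunctionSpaces.Torus.fderiv (ψ N) ((w' i).1 - x) (w' i).2) * kde N ψ h w' x (v) +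
        ∑ i, Literature.Analysis.FunctionSpaces.Torus.fderiv (ψ N) ((w' i).1 - x) (w' i).2 * gauss h (w' i).2 (v)) + δ *
        (localMaxwellian 1 (cT N ψ w' x + h ^ 2) (cU N ψ w' x) (v) * ((-(∑ i, Literature.Analysis.FunctionSpaces.Torus.fderiv (ψ N) ((w' i).1 -
        x) (w' i).2) * cT N ψ w' x + ∑ i, Literature.Analysis.FunctionSpaces.Torus.fderiv (ψ N) ((w' i).1 - x) (w' i).2 * (‖(w' i).2 -
        cU N ψ w' x‖ ^ 2 / 3)) * (‖(v) - cU N ψ w' x‖ ^ 2 / (2 * (cT N ψ w' x + h ^ 2) ^ 2) - 3 / (2 * (cT N ψ w' x + h ^ 2))) + inner ℝ ((v) -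
        cU N ψ w' x) (-(∑ i, Literature.Analysis.FunctionSpaces.Torus.fderiv (ψ N) ((w' i).1 - x) (w' i).2) • cU N ψ w' x +
        ∑ i, Literature.Analysis.FunctionSpaces.Torus.fderiv (ψ N) ((w' i).1 - x) (w' i).2 • (w' i).2) / (cT N ψ w' x + h ^ 2)))))| ≤
        (∑ i, |Literature.Analysis.FunctionSpaces.Torus.fderiv (ψ N) ((w' i).1 - x) (w' i).2|) * R) (r : ℝ) :
    DifferentiableAt ℝ (fun s => entS N ψ h δ (freeFlight (Torus.geometry (Fin 3)) s w)) r :=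
  (hasDerivAt_shift w (fun w' => entS N ψ h δ w')
    (hasDerivAt_entS (freeFlight (Torus.geometry (Fin 3)) r w) hψs hψ hψc hA hL (fun i => hV i) hh hδ hδ1 hR0
      (fun w' hw' x => hR w' (fun i => hw' i) x))).differentiableAt

/-! ## The transport rate is `O(L · ((N+1)^{-γ})³)` -/

/-- **SIZE OF THE TRANSPORT RATE.** If `|D_x| ≤ B₁(x) R` and the kernel is supported in the minimal-image
ball of radius `(N+1)^{-γ} < 1/2`, then `|∫ₓ (N+1)⁻¹ D_x dx| ≤ L V R · ((N+1)^{-γ})³ |B(0,1)|`. -/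
theorem abs_integral_Dx_le (hψ : ∀ y, 0 ≤ ψ N y) {γ L V R : ℝ}
    (hsupp : ∀ y, ((N : ℝ) + 1) ^ (-γ) ≤ Torus.euclidDist y 0 → ψ N y = 0)
    (hL : ∀ y, ‖Literature.Analysis.FunctionSpaces.Torus.gradient (ψ N) y‖ ≤ L) (hV : ∀ i, ‖(w i).2‖ ≤ V)
    (hR0 : 0 ≤ R) (hR : ∀ x, |((∑ i, Literature.Analysis.FunctionSpaces.Torus.fderiv (ψ N) ((w i).1 - x) (w i).2) * cellEnt N ψ h δ w x + ∫ v, (1 +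
        Real.log (cellLaw N ψ h δ w x v)) * ((1 - δ) * (-(∑ i, Literature.Analysis.FunctionSpaces.Torus.fderiv (ψ N) ((w i).1 - x) (w i).2) *
        kde N ψ h w x (v) + ∑ i, Literature.Analysis.FunctionSpaces.Torus.fderiv (ψ N) ((w i).1 - x) (w i).2 * gauss h (w i).2 (v)) + δ *
        (localMaxwellian 1 (cT N ψ w x + h ^ 2) (cU N ψ w x) (v) * ((-(∑ i, Literature.Analysis.FunctionSpaces.Torus.fderiv (ψ N) ((w i).1 -
        x) (w i).2) * cT N ψ w x + ∑ i, Literature.Analysis.FunctionSpaces.Torus.fderiv (ψ N) ((w i).1 - x) (w i).2 * (‖(w i).2 -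
        cU N ψ w x‖ ^ 2 / 3)) * (‖(v) - cU N ψ w x‖ ^ 2 / (2 * (cT N ψ w x + h ^ 2) ^ 2) - 3 / (2 * (cT N ψ w x + h ^ 2))) + inner ℝ ((v) -
        cU N ψ w x) (-(∑ i, Literature.Analysis.FunctionSpaces.Torus.fderiv (ψ N) ((w i).1 - x) (w i).2) • cU N ψ w x +
        ∑ i, Literature.Analysis.FunctionSpaces.Torus.fderiv (ψ N) ((w i).1 - x) (w i).2 • (w i).2) / (cT N ψ w x + h ^ 2)))))| ≤
        (∑ i, |Literature.Analysis.FunctionSpaces.Torus.fderiv (ψ N) ((w i).1 - x) (w i).2|) * R) (hRN : ((N : ℝ) + 1) ^ (-γ) < 1 / 2) :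
    |∫ x, ((N + 1 : ℕ) : ℝ)⁻¹ * ((∑ i, Literature.Analysis.FunctionSpaces.Torus.fderiv (ψ N) ((w i).1 - x) (w i).2) * cellEnt N ψ h δ w x + ∫ v, (1 +
        Real.log (cellLaw N ψ h δ w x v)) * ((1 - δ) * (-(∑ i, Literature.Analysis.FunctionSpaces.Torus.fderiv (ψ N) ((w i).1 - x) (w i).2) *
        kde N ψ h w x (v) + ∑ i, Literature.Analysis.FunctionSpaces.Torus.fderiv (ψ N) ((w i).1 - x) (w i).2 * gauss h (w i).2 (v)) + δ *
        (localMaxwellian 1 (cT N ψ w x + h ^ 2) (cU N ψ w x) (v) * ((-(∑ i, Literature.Analysis.FunctionSpaces.Torus.fderiv (ψ N) ((w i).1 -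
        x) (w i).2) * cT N ψ w x + ∑ i, Literature.Analysis.FunctionSpaces.Torus.fderiv (ψ N) ((w i).1 - x) (w i).2 * (‖(w i).2 -
        cU N ψ w x‖ ^ 2 / 3)) * (‖(v) - cU N ψ w x‖ ^ 2 / (2 * (cT N ψ w x + h ^ 2) ^ 2) - 3 / (2 * (cT N ψ w x + h ^ 2))) + inner ℝ ((v) -
        cU N ψ w x) (-(∑ i, Literature.Analysis.FunctionSpaces.Torus.fderiv (ψ N) ((w i).1 - x) (w i).2) • cU N ψ w x +
        ∑ i, Literature.Analysis.FunctionSpaces.Torus.fderiv (ψ N) ((w i).1 - x) (w i).2 • (w i).2) / (cT N ψ w x + h ^ 2)))))| ≤ L * V * R *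
        ((((N : ℝ) + 1) ^ (-γ)) ^ 3 * PastDamping.ballVol) := by
  have hN : (0 : ℝ) < ((N + 1 : ℕ) : ℝ) := by positivity
  have hV0 := V_nonneg w hV
  have hL0 := L_nonneg hL
  set ρ : ℝ := ((N : ℝ) + 1) ^ (-γ) with hρ
  have hρ0 : 0 < ρ := Real.rpow_pos_of_pos (by positivity) _
  -- the integrable majorant: indicators of the balls about the particles
  set g : T3 → ℝ := fun x => ((N + 1 : ℕ) : ℝ)⁻¹ * (L * V * R) *
    ∑ i, ({y : T3 | Torus.euclidDist y (w i).1 < ρ}).indicator (fun _ => (1 : ℝ)) x with hg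
  have hmeas : ∀ i, MeasurableSet {y : T3 | Torus.euclidDist y (w i).1 < ρ} :=
    fun i => PastDamping.measurableSet_euclidDist_lt _ _
  have hgI : Integrable g := by
    refine Integrable.const_mul (integrable_finsetSum _ fun i _ => ?_) _
    exact (integrable_const (1 : ℝ)).indicator (hmeas i)
  have hpt : ∀ x, ‖((N + 1 : ℕ) : ℝ)⁻¹ * ((∑ i, Literature.Analysis.FunctionSpaces.Torus.fderiv (ψ N) ((w i).1 - x) (w i).2) * cellEnt N ψ h δ w x +
      ∫ v, (1 + Real.log (cellLaw N ψ h δ w x v)) * ((1 - δ) * (-(∑ i, Literature.Analysis.FunctionSpaces.Torus.fderiv (ψ N) ((w i).1 - x) (w i).2) *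
      kde N ψ h w x (v) + ∑ i, Literature.Analysis.FunctionSpaces.Torus.fderiv (ψ N) ((w i).1 - x) (w i).2 * gauss h (w i).2 (v)) + δ *
      (localMaxwellian 1 (cT N ψ w x + h ^ 2) (cU N ψ w x) (v) * ((-(∑ i, Literature.Analysis.FunctionSpaces.Torus.fderiv (ψ N) ((w i).1 -
      x) (w i).2) * cT N ψ w x + ∑ i, Literature.Analysis.FunctionSpaces.Torus.fderiv (ψ N) ((w i).1 - x) (w i).2 * (‖(w i).2 -
      cU N ψ w x‖ ^ 2 / 3)) * (‖(v) - cU N ψ w x‖ ^ 2 / (2 * (cT N ψ w x + h ^ 2) ^ 2) - 3 / (2 * (cT N ψ w x + h ^ 2))) + inner ℝ ((v) -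
      cU N ψ w x) (-(∑ i, Literature.Analysis.FunctionSpaces.Torus.fderiv (ψ N) ((w i).1 - x) (w i).2) • cU N ψ w x +
      ∑ i, Literature.Analysis.FunctionSpaces.Torus.fderiv (ψ N) ((w i).1 - x) (w i).2 • (w i).2) / (cT N ψ w x + h ^ 2)))))‖ ≤ g x := by
    intro x
    rw [Real.norm_eq_abs, abs_mul, abs_of_pos (inv_pos.2 hN), hg]
    simp only
    rw [mul_assoc]
    refine mul_le_mul_of_nonneg_left ((hR x).trans ?_) (inv_pos.2 hN).le
    -- `B₁ ≤ L V Σ_i 1_{ball_i}`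
    have h1 : (∑ i, |Literature.Analysis.FunctionSpaces.Torus.fderiv (ψ N) ((w i).1 - x) (w i).2|) ≤ L * V *
        ∑ i, ({y : T3 | Torus.euclidDist y (w i).1 < ρ}).indicator (fun _ => (1 : ℝ)) x := by
      rw [Finset.mul_sum]
      refine Finset.sum_le_sum fun i _ => ?_
      by_cases hi : cw N ψ w x i = 0
      · rw [dcw_eq_zero_of w x hψ hi, abs_zero]
        exact mul_nonneg (mul_nonneg hL0 hV0) (Set.indicator_nonneg (fun _ _ => zero_le_one) _)
      · have hx : x ∈ {y : T3 | Torus.euclidDist y (w i).1 < ρ} := euclidDist_lt_of_cw_ne_zero w x hsupp hi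
        rw [Set.indicator_of_mem hx, mul_one]
        exact (abs_torusFderiv_le hL _ _).trans (mul_le_mul_of_nonneg_left (hV i) hL0)
    calc (∑ i, |Literature.Analysis.FunctionSpaces.Torus.fderiv (ψ N) ((w i).1 - x) (w i).2|) * R ≤ (L * V *
        ∑ i, ({y : T3 | Torus.euclidDist y (w i).1 < ρ}).indicator (fun _ => (1 : ℝ)) x) * R :=
          mul_le_mul_of_nonneg_right h1 hR0
      _ = L * V * R * ∑ i, ({y : T3 | Torus.euclidDist y (w i).1 < ρ}).indicator (fun _ => (1 : ℝ)) x := by ring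
  have h := norm_integral_le_of_norm_le hgI (ae_of_all _ hpt)
  rw [Real.norm_eq_abs] at h
  refine h.trans (le_of_eq ?_)
  -- evaluate `∫ g`
  rw [hg, integral_const_mul, integral_finsetSum _ fun i _ => (integrable_const (1 : ℝ)).indicator (hmeas i)]
  have hvol : ∀ i, ∫ x, ({y : T3 | Torus.euclidDist y (w i).1 < ρ}).indicator (fun _ => (1 : ℝ)) x = ρ ^ 3 * PastDamping.ballVol := by
    intro i
    rw [integral_indicator (hmeas i), setIntegral_const, smul_eq_mul, mul_one, measureReal_def,
      PastDamping.volumeReal_euclidDist_lt _ hρ0 hRN]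
  simp_rw [hvol]
  rw [Finset.sum_const, Finset.card_univ, Fintype.card_fin, nsmul_eq_mul]
  field_simp

/-- The admissible exponents: `((N+1)^{-γ})³ · (C (N+1)^{4γ}) = C (N+1)^{γ}`. -/
theorem rpow_support_mul_grad (C γ : ℝ) (N : ℕ) :
    (((N : ℝ) + 1) ^ (-γ)) ^ 3 * (C * ((N : ℝ) + 1) ^ (4 * γ)) = C * ((N : ℝ) + 1) ^ γ := by
  have hN : (0 : ℝ) < (N : ℝ) + 1 := by positivity
  rw [← Real.rpow_natCast, ← Real.rpow_mul hN.le]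
  have : ((N : ℝ) + 1) ^ (-γ * ((3 : ℕ) : ℝ)) * ((N : ℝ) + 1) ^ (4 * γ) = ((N : ℝ) + 1) ^ γ := by
    rw [← Real.rpow_add hN]; congr 1; push_cast; ring
  calc ((N : ℝ) + 1) ^ (-γ * ((3 : ℕ) : ℝ)) * (C * ((N : ℝ) + 1) ^ (4 * γ))
      = C * (((N : ℝ) + 1) ^ (-γ * ((3 : ℕ) : ℝ)) * ((N : ℝ) + 1) ^ (4 * γ)) := by ring
    _ = C * ((N : ℝ) + 1) ^ γ := by rw [this]


/-- A CRUDE BOUND, uniform in time, for every `N` (no support condition): with `|D_x| ≤ B₁ R`,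
`|d/dr S_N(freeFlight r w)| ≤ L V R` at every `r` (used only qualitatively, for the telescoping identity). -/
theorem abs_deriv_entS_le_crude (hψs : Torus.IsSmooth (ψ N)) (hψ : ∀ y, 0 ≤ ψ N y) (hψc : Continuous (ψ N))
    {A L V : ℝ} (hA : ∀ y, ψ N y ≤ A) (hL : ∀ y, ‖Literature.Analysis.FunctionSpaces.Torus.gradient (ψ N) y‖ ≤ L)
    (hV : ∀ i, ‖(w i).2‖ ≤ V) (hh : 0 < h) (hδ : 0 < δ) (hδ1 : δ ≤ 1) {R : ℝ} (hR0 : 0 ≤ R)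
    (hR : ∀ w' : Cfg N, (∀ i, (w' i).2 = (w i).2) → ∀ x, |((∑ i, Literature.Analysis.FunctionSpaces.Torus.fderiv (ψ N) ((w' i).1 - x) (w' i).2) *
        cellEnt N ψ h δ w' x + ∫ v, (1 + Real.log (cellLaw N ψ h δ w' x v)) * ((1 - δ) *
        (-(∑ i, Literature.Analysis.FunctionSpaces.Torus.fderiv (ψ N) ((w' i).1 - x) (w' i).2) * kde N ψ h w' x (v) +
        ∑ i, Literature.Analysis.FunctionSpaces.Torus.fderiv (ψ N) ((w' i).1 - x) (w' i).2 * gauss h (w' i).2 (v)) + δ *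
        (localMaxwellian 1 (cT N ψ w' x + h ^ 2) (cU N ψ w' x) (v) * ((-(∑ i, Literature.Analysis.FunctionSpaces.Torus.fderiv (ψ N) ((w' i).1 -
        x) (w' i).2) * cT N ψ w' x + ∑ i, Literature.Analysis.FunctionSpaces.Torus.fderiv (ψ N) ((w' i).1 - x) (w' i).2 * (‖(w' i).2 -
        cU N ψ w' x‖ ^ 2 / 3)) * (‖(v) - cU N ψ w' x‖ ^ 2 / (2 * (cT N ψ w' x + h ^ 2) ^ 2) - 3 / (2 * (cT N ψ w' x + h ^ 2))) + inner ℝ ((v) -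
        cU N ψ w' x) (-(∑ i, Literature.Analysis.FunctionSpaces.Torus.fderiv (ψ N) ((w' i).1 - x) (w' i).2) • cU N ψ w' x +
        ∑ i, Literature.Analysis.FunctionSpaces.Torus.fderiv (ψ N) ((w' i).1 - x) (w' i).2 • (w' i).2) / (cT N ψ w' x + h ^ 2)))))| ≤
        (∑ i, |Literature.Analysis.FunctionSpaces.Torus.fderiv (ψ N) ((w' i).1 - x) (w' i).2|) * R) (r : ℝ) :
    |deriv (fun s => entS N ψ h δ (freeFlight (Torus.geometry (Fin 3)) s w)) r| ≤ L * V * R := by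
  have hN : (0 : ℝ) < ((N + 1 : ℕ) : ℝ) := by positivity
  rw [deriv_shift w (fun w' => entS N ψ h δ w') r,
    (hasDerivAt_entS (freeFlight (Torus.geometry (Fin 3)) r w) hψs hψ hψc hA hL (fun i => hV i) hh hδ hδ1 hR0 (fun w' hw' x => hR w' (fun i => hw' i) x)).deriv]
  have hpt : ∀ x, ‖((N + 1 : ℕ) : ℝ)⁻¹ *
      ((∑ i, Literature.Analysis.FunctionSpaces.Torus.fderiv (ψ N) (((freeFlight (Torus.geometry (Fin 3)) r w) i).1 -
      x) ((freeFlight (Torus.geometry (Fin 3)) r w) i).2) * cellEnt N ψ h δ (freeFlight (Torus.geometry (Fin 3)) r w) x + ∫ v, (1 +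
      Real.log (cellLaw N ψ h δ (freeFlight (Torus.geometry (Fin 3)) r w) x v)) * ((1 - δ) *
      (-(∑ i, Literature.Analysis.FunctionSpaces.Torus.fderiv (ψ N) (((freeFlight (Torus.geometry (Fin 3)) r w) i).1 -
      x) ((freeFlight (Torus.geometry (Fin 3)) r w) i).2) * kde N ψ h (freeFlight (Torus.geometry (Fin 3)) r w) x (v) +
      ∑ i, Literature.Analysis.FunctionSpaces.Torus.fderiv (ψ N) (((freeFlight (Torus.geometry (Fin 3)) r w) i).1 -
      x) ((freeFlight (Torus.geometry (Fin 3)) r w) i).2 * gauss h ((freeFlight (Torus.geometry (Fin 3)) r w) i).2 (v)) + δ *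
      (localMaxwellian 1 (cT N ψ (freeFlight (Torus.geometry (Fin 3)) r w) x + h ^ 2) (cU N ψ (freeFlight (Torus.geometry (Fin 3)) r w) x) (v) *
      ((-(∑ i, Literature.Analysis.FunctionSpaces.Torus.fderiv (ψ N) (((freeFlight (Torus.geometry (Fin 3)) r w) i).1 -
      x) ((freeFlight (Torus.geometry (Fin 3)) r w) i).2) * cT N ψ (freeFlight (Torus.geometry (Fin 3)) r w) x +
      ∑ i, Literature.Analysis.FunctionSpaces.Torus.fderiv (ψ N) (((freeFlight (Torus.geometry (Fin 3)) r w) i).1 -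
      x) ((freeFlight (Torus.geometry (Fin 3)) r w) i).2 * (‖((freeFlight (Torus.geometry (Fin 3)) r w) i).2 -
      cU N ψ (freeFlight (Torus.geometry (Fin 3)) r w) x‖ ^ 2 / 3)) * (‖(v) - cU N ψ (freeFlight (Torus.geometry (Fin 3)) r w) x‖ ^ 2 / (2 *
      (cT N ψ (freeFlight (Torus.geometry (Fin 3)) r w) x + h ^ 2) ^ 2) - 3 / (2 * (cT N ψ (freeFlight (Torus.geometry (Fin 3)) r w) x + h ^ 2))) +
      inner ℝ ((v) -
      cU N ψ (freeFlight (Torus.geometry (Fin 3)) r w) x) (-(∑ i, Literature.Analysis.FunctionSpaces.Torus.fderiv (ψ N) (((freeFlight (Torus.geometry (Fin 3)) r w) i).1 -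
      x) ((freeFlight (Torus.geometry (Fin 3)) r w) i).2) • cU N ψ (freeFlight (Torus.geometry (Fin 3)) r w) x +
      ∑ i, Literature.Analysis.FunctionSpaces.Torus.fderiv (ψ N) (((freeFlight (Torus.geometry (Fin 3)) r w) i).1 -
      x) ((freeFlight (Torus.geometry (Fin 3)) r w) i).2 • ((freeFlight (Torus.geometry (Fin 3)) r w) i).2) / (cT N ψ (freeFlight (Torus.geometry (Fin 3)) r w) x +
      h ^ 2)))))‖ ≤ L * V * R := by
    intro x
    rw [Real.norm_eq_abs, abs_mul, abs_of_pos (inv_pos.2 hN)]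
    have h1 := hR (freeFlight (Torus.geometry (Fin 3)) r w) (fun i => rfl) x
    have h2 := B1_le (freeFlight (Torus.geometry (Fin 3)) r w) x hL (fun i => hV i)
    calc ((N + 1 : ℕ) : ℝ)⁻¹ * |((∑ i, Literature.Analysis.FunctionSpaces.Torus.fderiv (ψ N) (((freeFlight (Torus.geometry (Fin 3)) r w) i).1 -
        x) ((freeFlight (Torus.geometry (Fin 3)) r w) i).2) * cellEnt N ψ h δ (freeFlight (Torus.geometry (Fin 3)) r w) x + ∫ v, (1 +
        Real.log (cellLaw N ψ h δ (freeFlight (Torus.geometry (Fin 3)) r w) x v)) * ((1 - δ) *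
        (-(∑ i, Literature.Analysis.FunctionSpaces.Torus.fderiv (ψ N) (((freeFlight (Torus.geometry (Fin 3)) r w) i).1 -
        x) ((freeFlight (Torus.geometry (Fin 3)) r w) i).2) * kde N ψ h (freeFlight (Torus.geometry (Fin 3)) r w) x (v) +
        ∑ i, Literature.Analysis.FunctionSpaces.Torus.fderiv (ψ N) (((freeFlight (Torus.geometry (Fin 3)) r w) i).1 -
        x) ((freeFlight (Torus.geometry (Fin 3)) r w) i).2 * gauss h ((freeFlight (Torus.geometry (Fin 3)) r w) i).2 (v)) + δ *
        (localMaxwellian 1 (cT N ψ (freeFlight (Torus.geometry (Fin 3)) r w) x + h ^ 2) (cU N ψ (freeFlight (Torus.geometry (Fin 3)) r w) x) (v) *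
        ((-(∑ i, Literature.Analysis.FunctionSpaces.Torus.fderiv (ψ N) (((freeFlight (Torus.geometry (Fin 3)) r w) i).1 -
        x) ((freeFlight (Torus.geometry (Fin 3)) r w) i).2) * cT N ψ (freeFlight (Torus.geometry (Fin 3)) r w) x +
        ∑ i, Literature.Analysis.FunctionSpaces.Torus.fderiv (ψ N) (((freeFlight (Torus.geometry (Fin 3)) r w) i).1 -
        x) ((freeFlight (Torus.geometry (Fin 3)) r w) i).2 * (‖((freeFlight (Torus.geometry (Fin 3)) r w) i).2 -
        cU N ψ (freeFlight (Torus.geometry (Fin 3)) r w) x‖ ^ 2 / 3)) * (‖(v) - cU N ψ (freeFlight (Torus.geometry (Fin 3)) r w) x‖ ^ 2 / (2 *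
        (cT N ψ (freeFlight (Torus.geometry (Fin 3)) r w) x + h ^ 2) ^ 2) - 3 / (2 * (cT N ψ (freeFlight (Torus.geometry (Fin 3)) r w) x + h ^ 2))) +
        inner ℝ ((v) -
        cU N ψ (freeFlight (Torus.geometry (Fin 3)) r w) x) (-(∑ i, Literature.Analysis.FunctionSpaces.Torus.fderiv (ψ N) (((freeFlight (Torus.geometry (Fin 3)) r w) i).1 -
        x) ((freeFlight (Torus.geometry (Fin 3)) r w) i).2) • cU N ψ (freeFlight (Torus.geometry (Fin 3)) r w) x +
        ∑ i, Literature.Analysis.FunctionSpaces.Torus.fderiv (ψ N) (((freeFlight (Torus.geometry (Fin 3)) r w) i).1 -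
        x) ((freeFlight (Torus.geometry (Fin 3)) r w) i).2 • ((freeFlight (Torus.geometry (Fin 3)) r w) i).2) / (cT N ψ (freeFlight (Torus.geometry (Fin 3)) r w) x +
        h ^ 2)))))| ≤ ((N + 1 : ℕ) : ℝ)⁻¹ * (((N + 1 : ℕ) : ℝ) * L * V * R) :=
          mul_le_mul_of_nonneg_left (h1.trans (mul_le_mul_of_nonneg_right h2 hR0)) (inv_pos.2 hN).le
      _ = L * V * R := by field_simp
  have h := norm_integral_le_of_norm_le (integrable_const (μ := (volume : Measure T3)) (L * V * R)) (ae_of_all _ hpt)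
  rw [Real.norm_eq_abs, integral_const, smul_eq_mul, probReal_univ, one_mul] at h
  exact h

end EntropyBudget

/-- Registered anchor of this helper file (`--supports stmt-AtomisticToContinuum-14868`, helper of
`stub_entropyBudget`): the admissible exponents: support volume times gradient bound is C (N+1)^γ. -/
theorem bhEntropyBudget_transport_anchor : ∀ (C γ : ℝ) (N : ℕ), (((N : ℝ) + 1) ^ (-γ)) ^ 3 * (C * ((N : ℝ) + 1) ^ (4 * γ)) = C * ((N : ℝ) + 1) ^ γ :=
  fun C γ N => EntropyBudget.rpow_support_mul_grad C γ N

end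

end Summit.AtomisticToContinuum.HydrodynamicLimit.Theorems.BlockHDissipation
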